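import Summits.BirchSwinnertonDyer.BirchSwinnertonDyer.Theorems.ErratumRoadFiveEulerHalfNotRamE0PrimeReceptacle
import Summits.BirchSwinnertonDyer.Rank1Residual.X11b.BDPRouteTamagawaSupport
import Literature.NumberTheory.EllipticCurves.RingClassGalOverCyclicProofs
import Literature.NumberTheory.EllipticCurves.RingClassFieldDecompositionLaw
import HarnessLib

/-!
# Route `ErratumRoadFive` (K2, `p ≥ 5`), crux `EulerHalfNotRamNoInertSetAtFive` (item stmt-BirchSwinnertonDyer-19715), line `birth` v15 (= v14 ⊕ the
# `aux_norm_receptacle` graft): THE SIX STATEMENTS OF THE AUXILIARY-NORM LEVER AS NAMED DEFINITIONS — S1 `TateComponentFamily`, S3 `AuxiliaryInertLevel`,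
# S2♭ `RelativeStabilizerLaw`, S3♭ `AuxiliaryPrimeSupply`, (C) `ChebotarevKummerSupply`, (O) `SplitPrimeKummerWitness`
# (cell `bsd-stepL`, LEAD `bsd-line-er5-p1` g3; DEF-ONLY file, `--kind definition --supports stmt-BirchSwinnertonDyer-19715`)

PROVENANCE. The six `def … : Prop` bodies below are VERBATIM §1 of the ideator's crux workfile
`Summits/BirchSwinnertonDyer/BirchSwinnertonDyer/Cruxes/EulerHalfNotRamNoInertSetAtFive/Lines/aux_norm_receptacle.lean` v4 (bsd-idea-9 g8, commit 193b9164b81b,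
sha16 f729ad49848336fd; critic idea-crit-14 VERDICT #50 PASS «typed-truth read of all four leaf stubs»), moved under `…Theorems.AuxNormReceptacle` so that
(i) the sorry-free composition of that file can live in the BUILD as an importable Theorems module (`ErratumRoadFiveAuxNormReceptacle.lean`), (ii) the four
leaf stubs of skeleton v15 of line `birth` (`stub_tateComponentFamily`, `stub_relativeStabilizerLaw`, `stub_chebotarevKummerSupply`, `stub_splitPrimeKummerWitness`)
are REGISTERED over short, stable statement names, and (iii) the width seats' landed proofs (-w2 (C)∕(O), -w3 S1, -w4 S2♭) state exactly these Props.
Crux workfiles are not importable; this file is the tree's copy of the VOCABULARY only — no theorem, no `sorry`, no named fact, no instance, no notation.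

WHAT THE LEVER IS (one paragraph; the card `Cruxes/…/Ideas/aux-norm-receptacle.md` has the rest). The walk of crux 19715 needs, at each K-SPLIT multiplicative
carrier `q ∉ S` with `p ∣ c_q(E)`, only Gross's E′-label «`n' • y_m ∈ E₀(K[m])_w` for ONE `n'` prime to `p`» (width seat -w3 g5's binder `hE0T`), not the
identity-component label (B6) of item 27982 `ShimuraCarrierLabelsB6FromFive`. Reading Gross's norm relation (B4) at an AUXILIARY inert level `ℓ₀ m` through the
Tate component character `comp_w : E(K[m]) → ℤ/c_q` (S1) gives `∑_{i ≤ ℓ₀} comp(σ^{-i} w̃)(y_{ℓ₀m}) = a_{ℓ₀} · comp_w(y_m)`; the left side is a multiple of the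
stabiliser order `#Stab_{⟨σ⟩}(w̃)` (orbit counting), which S3 makes divisible by `p^{ord_p c_q}` while `p ∤ a_{ℓ₀}` — so `(c_q / p^{ord_p c_q}) • y_m ∈ ker comp_w = E₀`.
S3 is DERIVED from S2♭ (ring class CFT: the stabiliser is the relative decomposition group, its order the relative residue degree) and S3♭ (a prime `ℓ₀` of
prime conductor with `p^E ∣ orderOf [𝔭_v]_{ℓ₀}`), and S3♭ from (C) (ONE explicit Chebotarev class in `K(E[p^E], γ^{1/p})/ℚ`, Serre's open image for
`p ≥ 5` under (surj)) and (O) (the Kummer witness `γ` of a split prime: CFT of orders in `K` + Hilbert 90) — both derivations are sorry-free theorems of the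
companion file. HONEST FRAMING: definitions only; nothing is asserted; item 19715 is NOT closed by this file; no census number moves; BSD is proved for no
curve; no summit statement is touched.

References (locators only): [cite: GrossLMS1991, §3 Prop. 3.7 (1) (p. 239), §6 proof of Prop. 6.2 (1) (p. 245)] [cite: SilvermanATAEC1994, IV Cor. 9.2 (d), V Thm. 3.1, C.15]
[cite: SilvermanAEC2009, VII Prop. 2.1] [cite: Cox2013, §7.C Prop. 7.22, §7.D Thm. 7.24, (7.25)–(7.27), Thm. 8.12, §9.A] [cite: Serre1972, §4.4 Lemme 3]
[cite: NeukirchANT1999, Ch. I §8 (8.3), §9 (9.4), Ch. VI §7 Thm. (7.3)]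
-/

set_option autoImplicit false
set_option linter.dupNamespace false -- `Summit.BirchSwinnertonDyer.BirchSwinnertonDyer` (summit = problem), tree-wide

noncomputable section

open scoped Classical NumberField Pointwise

namespace Summit.BirchSwinnertonDyer.BirchSwinnertonDyer.Theorems.AuxNormReceptacle

open WeierstrassCurve IsDedekindDomain NumberField Field Literature.NumberTheory.EllipticCurves
  Literature.NumberTheory.GaloisRepresentations Summit.BirchSwinnertonDyer.Rank1Residual.X11b
  Summit.BirchSwinnertonDyer.BirchSwinnertonDyer.Theorems Rat.HeightOneSpectrum
  Literature.NumberTheory.NumberFields Literature.NumberTheory.NumberFields.RingClassField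
  Literature.NumberTheory.QuadraticFields.RingClass

variable (W : WeierstrassCurve ℚ) [W.IsElliptic] [W.IsGloballyMinimal] (K : Type) [Field K] [NumberField K]
  (ι : K →+* ℂ)

/-- **S1 — the Tate component characters on the CM tower at a split multiplicative prime `q`.** A family
`comp n w : E(K[n]) →+ ℤ/c`, `c = ord_q Δ_min(E)`, over the levels `n ≥ 1` prime to `q` and the places `w ∋ q` of `K[n]`, with:
(K1) `comp n w P = 0 ↔ P ∈ E₀(K[n])_w` (nonsingular reduction on the globally minimal `W`; `q` is unramified in `K[n]`, so `W` stays
minimal at `w` and `Φ_w ≅ ℤ/c`, Kodaira–Néron for split `I_c`); (K2) compatibility with the inclusion `K[n₀] → K[n]` (`n₀ ∣ n`; every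
`w₀ ∋ q` of `K[n₀]` lies under some `w ∋ q` of `K[n]`, `e(w ∣ w₀) = 1`); (K3) Galois covariance `comp_{τ w'}(τ P) = comp_{w'}(P)`
(`τ • 𝔓 = τ(𝔓)`, Mathlib's pointwise action of `Aut_ℚ(K[n])` on the ideals of `𝓞 K[n]`; the Tate parameter `q_E ∈ ℚ_q` is rational).
Informal content: Silverman ATAEC V §4–5 (Tate curve `E_q(L_w) ≅ L_w^×/q_E^ℤ` functorial in unramified `L_w/ℚ_q`), IV Cor. 9.2 (d),
C.15; tree twins at ONE Henselian place: `TateNormalFormComponents.exists_addMonoidHom_zmod_of_tateNormalForm`,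
`TateNormalFormUnramifiedComponentsProofs.exists_rational_generator_of_tateNormalForm`, `MultiplicativeComponentGroupOrder.*`.
Why (K1)–(K3) are simultaneously satisfiable with VALUES matching (critic V46): ONE Tate uniformisation of `E/ℚ_q` (unique up to
`[−1]`, `j ∉ ℤ_q ⇒ Aut = ±1`) base-changes to every completion `K[n]_w`, `w ∣ q` unramified, so `comp n w := ord_w ∘ (Tate coordinate)
mod c` is one coherent choice. A statement; asserted only by `stub_tateComponentFamily`. [cite: SilvermanATAEC1994, IV Cor. 9.2 (d), V Thm. 3.1, V Lemma 5.? ; C.15]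
[cite: SilvermanAEC2009, VII Prop. 2.1] -/
def TateComponentFamily [∀ j : ℕ, NumberField (ringClassField K ι j)] (q : ℕ) : Prop :=
  ∃ comp : (n : ℕ) → HeightOneSpectrum (𝓞 (ringClassField K ι n)) →
      ((W.baseChange (ringClassField K ι n)).toAffine.Point →+ ZMod (padicValInt q W.minimalDiscriminantInt)),
    (∀ n : ℕ, n ≠ 0 → ¬ q ∣ n → ∀ (w : HeightOneSpectrum (𝓞 (ringClassField K ι n))),
        ((q : ℕ) : 𝓞 (ringClassField K ι n)) ∈ w.asIdeal →
        ∀ P : (W.baseChange (ringClassField K ι n)).toAffine.Point,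
          comp n w P = 0 ↔
            (placeIntModel W (ringClassField K ι n) w).HasNonsingularReduction (K := ringClassField K ι n) P) ∧
    (∀ n n₀ : ℕ, n ≠ 0 → ¬ q ∣ n → n₀ ∣ n →
        ∀ f : ringClassField K ι n₀ →ₐ[ℚ] ringClassField K ι n,
          (∀ x : ringClassField K ι n₀, ((f x : ringClassField K ι n) : ℂ) = (x : ℂ)) →
        ∀ w₀ : HeightOneSpectrum (𝓞 (ringClassField K ι n₀)),
          ((q : ℕ) : 𝓞 (ringClassField K ι n₀)) ∈ w₀.asIdeal →
        ∃ w : HeightOneSpectrum (𝓞 (ringClassField K ι n)), ((q : ℕ) : 𝓞 (ringClassField K ι n)) ∈ w.asIdeal ∧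
          ∀ P : (W.baseChange (ringClassField K ι n₀)).toAffine.Point,
            comp n w (WeierstrassCurve.Affine.Point.map (W' := W) f P) = comp n₀ w₀ P) ∧
    (∀ n : ℕ, n ≠ 0 → ¬ q ∣ n → ∀ (τ : ringClassField K ι n ≃ₐ[ℚ] ringClassField K ι n)
        (w w' : HeightOneSpectrum (𝓞 (ringClassField K ι n))),
        w.asIdeal = τ • w'.asIdeal →
        ∀ P : (W.baseChange (ringClassField K ι n)).toAffine.Point,
          comp n w (pointGalHom W (ringClassField K ι n) τ P) = comp n w' P)

/-- **S3 (⊇ S2) — the auxiliary inert level.** For every exponent `e` and every guarded level `m₀` there is a prime `ℓ₀ ∤ N m₀`, inert in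
`K`, with `p ∤ a_{ℓ₀}(E)`, such that for every generator `σ` of `G_{ℓ₀} = Gal(K[ℓ₀ m₀]/K[m₀])` (`ringClassGalOver ι (ℓ₀ m₀) m₀`):
`σ^{ℓ₀+1} = 1` (`#G_{ℓ₀} = ℓ₀ + 1`, `d_K < −4`) and `p^e` divides the order of the stabiliser in `⟨σ⟩` of every prime `w̃ ∋ q` of
`K[ℓ₀ m₀]` (= the decomposition group, of order the residue degree `f(w̃ ∣ w̃ ∩ K[m₀])` since `q ∤ ℓ₀` is unramified). Informal proof
(S2 = ring class CFT: `f(w̃ ∣ w) = ord(β̄/β mod ℓ₀)` in `𝔽_{ℓ₀²}^×/𝔽_{ℓ₀}^× ≅ μ_{ℓ₀+1}`, `(β) = 𝔮^{f(w ∣ 𝔮)}`; S3 = Chebotarev in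
`M = K(E[p^{e'}], (β̄₁/β₁)^{1/p})`, `e' = e + ord_p(f(w∣𝔮)/h_𝔮)`, class `σ|_K ≠ 1`, `ρ(σ) ~ diag(2, −2⁻¹)` (det `−1` ⟹ `ℓ₀ ≡ −1 (p^{e'})`,
trace `3/2 ≢ 0`), `σ²` non-trivial on the Kummer radical — admissible since `ρ_{E,p^∞}(G_ℚ) = GL₂(ℤ_p)` for `p ≥ 5` under (surj)
(Serre) and `SL₂(ℤ/p^{e'})` is perfect, so `(β̄₁/β₁)^{1/p} ∉ K(E[p^{e'}])` as `β̄₁/β₁ ∉ K^{×p}`). A statement; since v3 it is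
DERIVED: `auxiliaryInertLevel_of_laws : RelativeStabilizerLaw → AuxiliaryPrimeSupply → AuxiliaryInertLevel` (sorry-free). [cite: GrossLMS1991, §3 (p. 239: G_ℓ ≅ 𝔽_λ^×/𝔽_ℓ^× cyclic of order ℓ+1)] [cite: Cox2013, Thm. 7.24, §9.A]
[cite: Serre1972, §4.4 Lemme 3] -/
def AuxiliaryInertLevel [∀ j : ℕ, NumberField (ringClassField K ι j)] (p q N : ℕ) : Prop :=
  ∀ e m₀ : ℕ, Squarefree m₀ → (∀ r ∈ m₀.primeFactors, ¬ r ∣ N ∧ (Ideal.span {(r : 𝓞 K)}).IsPrime) →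
    ∃ ℓ₀ : ℕ, ℓ₀.Prime ∧ ¬ ℓ₀ ∣ N ∧ ¬ ℓ₀ ∣ m₀ ∧ (Ideal.span {(ℓ₀ : 𝓞 K)}).IsPrime ∧
      ¬ (p : ℤ) ∣ W.frobeniusTrace ℓ₀ ∧
      ∀ σ : ringClassField K ι (ℓ₀ * m₀) ≃ₐ[ℚ] ringClassField K ι (ℓ₀ * m₀),
        Subgroup.zpowers σ = ringClassGalOver ι (ℓ₀ * m₀) m₀ →
        σ ^ (ℓ₀ + 1) = 1 ∧
        ∀ w : HeightOneSpectrum (𝓞 (ringClassField K ι (ℓ₀ * m₀))),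
          ((q : ℕ) : 𝓞 (ringClassField K ι (ℓ₀ * m₀))) ∈ w.asIdeal →
          p ^ e ∣ Nat.card (MulAction.stabilizer (Subgroup.zpowers σ) w.asIdeal)

/-- **S2♭ — the relative stabiliser law in the ring class tower** (pure class field theory of orders; v3 split of S3). For
`m₀ ≥ 1`, a prime `ℓ₀ ∤ m₀` inert in `K`, `q ∤ ℓ₀ m₀`, and any generator `σ` of `G_{ℓ₀} = ringClassGalOver ι (ℓ₀ m₀) m₀`:
`σ^{ℓ₀+1} = 1` (`#G_{ℓ₀} ∣ ℓ₀ + 1`, Gross §3 / Cox Thm. 7.24), and for every prime `w̃ ∋ q` of `K[ℓ₀ m₀]` the prime `v` of `K`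
below it satisfies `#Stab_{⟨σ⟩}(w̃) · orderOf [𝔭_v]_{m₀} = orderOf [𝔭_v]_{ℓ₀ m₀}` — i.e. the stabiliser (= decomposition group of `w̃`
in `K[ℓ₀m₀]/K[m₀]`, Mathlib `Ideal.card_stabilizer_eq`: order `e·f = f(w̃ ∣ w̃ ∩ K[m₀])`, `e = 1` by
`ramificationIdx_ringClassField_eq_one`) has order the relative residue degree, which the landed relative decomposition law
`inertiaDeg_mul_orderOf_primeClass_eq_of_tower` (bsd-line-er5-p1-w4 g7, p638696) expresses through `orderOf (primeClass · v)`.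
A statement; asserted only by `stub_relativeStabilizerLaw`. [cite: NeukirchANT1999, Ch. VI §7 Thm. (7.3); Ch. I §9 (9.4)]
[cite: Cox2013, §7.D Thm. 7.24, §9.A] [cite: GrossLMS1991, §3 (p. 239)] -/
def RelativeStabilizerLaw [∀ j : ℕ, NumberField (ringClassField K ι j)] (q : ℕ) : Prop :=
  ∀ m₀ ℓ₀ : ℕ, m₀ ≠ 0 → ℓ₀.Prime → ¬ ℓ₀ ∣ m₀ → (Ideal.span {(ℓ₀ : 𝓞 K)}).IsPrime → ¬ q ∣ ℓ₀ * m₀ →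
    ∀ σ : ringClassField K ι (ℓ₀ * m₀) ≃ₐ[ℚ] ringClassField K ι (ℓ₀ * m₀),
      Subgroup.zpowers σ = ringClassGalOver ι (ℓ₀ * m₀) m₀ →
      σ ^ (ℓ₀ + 1) = 1 ∧
      ∀ w : HeightOneSpectrum (𝓞 (ringClassField K ι (ℓ₀ * m₀))),
        ((q : ℕ) : 𝓞 (ringClassField K ι (ℓ₀ * m₀))) ∈ w.asIdeal →
        ∃ v : HeightOneSpectrum (𝓞 K), ((q : ℕ) : 𝓞 K) ∈ v.asIdeal ∧
          Nat.card (MulAction.stabilizer (Subgroup.zpowers σ) w.asIdeal) * orderOf (primeClass m₀ v) =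
            orderOf (primeClass (ℓ₀ * m₀) v)

/-- **S3♭ — the auxiliary prime supply at PRIME conductor** (Chebotarev–Kummer; v3 split of S3; `ι`-free). For every exponent `E`
and every finite exclusion set `T`: a prime `ℓ₀ ∉ T`, `ℓ₀ ∤ N`, inert in `K`, with `p ∤ a_{ℓ₀}(E)` and `p^E ∣ orderOf [𝔭_v]_{ℓ₀}`
for BOTH primes `v ∣ q` of `K` (ring class group of prime conductor `ℓ₀`). Informal proof: `orderOf [𝔮]_{ℓ₀} = h_𝔮 · ord(x₁ mod ℓ₀)`
in `(𝒪_K/ℓ₀)^×/(ℤ/ℓ₀)^× ≅ μ_{ℓ₀+1}` (`(β₁) = 𝔮^{h_𝔮}` minimal, `x₁ = β̄₁/β₁ = q^{h_𝔮}/β₁²`; Cox (7.27) at prime conductor;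
`[𝔮̄]_{ℓ₀} = [𝔮]_{ℓ₀}^{-1}`), and Chebotarev in `M = K(E[p^E], x₁^{1/p})` (Galois over ℚ) with `σ = σ₀ a`, `σ₀|_K = conj`,
`ρ(σ₀) = diag(2, −2^{-1})` (det `−1` ⇒ `p^E ∣ ℓ₀ + 1`; trace `3/2`, `p ≥ 5`), `a ∈ A = Gal(M/K(E[p^E])) ≅ ℤ/p`: LOAD-BEARING
EXCLUSION (critic V43 (c)) `A ≠ 1` — `SL₂(ℤ/p^E)` perfect ⇒ `x₁^{1/p} ∈ K(E[p^E])` would force `x₁ ∈ K(μ_{p^E})^{×p}`, then (Kummer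
line over `K(μ_p)` trivial or `= K(μ_{p²})`) `x₁ ∈ K^{×p}`, and `β̄₁ = β₁δ^p` ⇒ (Hilbert 90, `β₁ = r ε^p`, `r ∈ ℚ^×`) `[𝔮]^{h_𝔮/p} = 1`,
contradicting minimality of `h_𝔮`; since `x̄₁ = x₁^{-1}` exactly, conj acts trivially on `A` and `σ² = σ₀² a²` sweeps the coset
`σ₀² A` (`p` odd), so all but at most one lift `σ` move `x₁^{1/p}`, i.e. `x₁` is not a `p`-th power mod `ℓ₀` (`Frob_{(ℓ₀)}(M/K) = σ²`,
`μ_p ⊂ 𝔽_{ℓ₀²}`), whence `v_p ord(x₁ mod ℓ₀) = v_p(ℓ₀² − 1) = v_p(ℓ₀ + 1) ≥ E`. Excluded finite set: `T ∪ {ℓ ∣ 2 p q N·N(β₁)·disc M}`.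
Needs (surj) and `p ≥ 5` (`ρ_{E,p^∞}(G_ℚ) = GL₂(ℤ_p)`, Serre), `q` split in `K` (for inert `q`, `[𝔮]_{ℓ₀} = 1` and the clause
fails for `E ≥ 1`). A statement; since v4 DERIVED: `auxiliaryPrimeSupply_of_CO : ChebotarevKummerSupply → SplitPrimeKummerWitness → AuxiliaryPrimeSupply`. [cite: Cox2013, §7.D (7.27), Thm. 8.12 (Chebotarev), §9.A]
[cite: Serre1972, §4.4 Lemme 3] [cite: GrossLMS1991, §3 (p. 239)] -/
def AuxiliaryPrimeSupply (p q N : ℕ) : Prop :=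
  ∀ (E : ℕ) (T : Finset ℕ), ∃ ℓ₀ : ℕ, ℓ₀.Prime ∧ ℓ₀ ∉ T ∧ ¬ ℓ₀ ∣ N ∧ (Ideal.span {(ℓ₀ : 𝓞 K)}).IsPrime ∧
    ¬ (p : ℤ) ∣ W.frobeniusTrace ℓ₀ ∧
    ∀ v : HeightOneSpectrum (𝓞 K), ((q : ℕ) : 𝓞 K) ∈ v.asIdeal → p ^ E ∣ orderOf (primeClass ℓ₀ v)

/-- **(C) — generic Chebotarev–Kummer supply** (v4 split of S3♭; the ONLY place Chebotarev and Serre enter the line; `q`-free).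
For every exponent `E`, finite exclusion set `T`, and `γ ∈ 𝓞 K ∖ {0}` with `N_{K/ℚ}(γ) ∈ ℚ^{×p}` and `γ ∉ K^{×p}`: a prime `ℓ₀ ∉ T`, inert
in `K`, with `p ∤ a_{ℓ₀}(E)`, `p^E ∣ ℓ₀ + 1`, and `γ` NOT a `p`-th power modulo `ℓ₀𝓞_K` (`= 𝔽_{ℓ₀²}`). Informal proof: `F := K(E[p^E])`,
`M := F(γ^{1/p})` is Galois over `ℚ` (`conj γ = N(γ)/γ`, `N(γ)^{1/p} ∈ ℚ`; `μ_p ⊂ F`); `γ^{1/p} ∉ F` since `Gal(F/K(μ_p))^{ab}` is the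
`det`-quotient `1 + pℤ/p^E` (`SL₂(ℤ/p^E)` perfect, `p ≥ 5`, image `⊇ SL₂` under (surj) by Serre), so `K(μ_p, γ^{1/p}) ⊂ F` would give
`γ ∈ μ(K)·K^{×p} = K^{×p}` (`d_K < −4`); take `g = g₀ a`, `g₀|_K = conj`, `ρ(g₀) = diag(2, −2^{-1})` (in the image: `GL₂(ℤ/p^E)`, and for
`K = ℚ(√−p) ⊂ ℚ(E[p])`, `p ≡ 3 (4)`, `det = −1` is a non-residue so `g₀|_K = conj` is consistent), `a ∈ A := Gal(M/F) ≅ ℤ/p`; as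
`χ(g₀) ≡ −1` and `conj γ^{1/p} = N(γ)^{1/p}/γ^{1/p}`, `g₀` centralises `A`, so `(g₀a)² = g₀² a²` sweeps `g₀² A` (`p` odd) and all but at most
one `a` give `g²` moving `γ^{1/p}`; Chebotarev (`Frob_{ℓ₀}(M/ℚ) ∼ g`, away from `T` and the primes dividing `2 p N_E N(γ) disc M`) yields
`ℓ₀` inert (`g|_K ≠ 1`), `a_{ℓ₀} ≡ tr = 3/2 ≢ 0`, `ℓ₀ ≡ det = −1 (mod p^E)`, and `Frob_{λ₀}(M/K) = g²` moving `γ^{1/p}` — whence `γ̄ ∉ 𝔽_{λ₀}^{×p}`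
(else `T^p − γ̄` splits into distinct linear factors, `μ_p ⊂ 𝔽_{λ₀}`, Hensel, and every decomposition group above `λ₀` fixes each `p`-th
root). A statement; asserted only by `stub_chebotarevKummerSupply`. [cite: Cox2013, Thm. 8.12 (Chebotarev), §9.A] [cite: Serre1972, §4.4 Lemme 3]
[cite: NeukirchANT1999, Ch. I §8 (8.3) (Dedekind–Kummer)] -/
def ChebotarevKummerSupply (p : ℕ) : Prop :=
  ∀ (E : ℕ) (T : Finset ℕ) (γ : 𝓞 K) (r : ℚ), γ ≠ 0 → Algebra.norm ℚ (γ : K) = r ^ p → (∀ y : K, y ^ p ≠ (γ : K)) →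
    ∃ ℓ₀ : ℕ, ℓ₀.Prime ∧ ℓ₀ ∉ T ∧ (Ideal.span {(ℓ₀ : 𝓞 K)}).IsPrime ∧ ¬ (p : ℤ) ∣ W.frobeniusTrace ℓ₀ ∧ p ^ E ∣ ℓ₀ + 1 ∧
      ¬ ∃ y : 𝓞 K, y ^ p - γ ∈ Ideal.span {(ℓ₀ : 𝓞 K)}

/-- **(O) — the Kummer witness of a split prime and the order law at prime conductor** (v4 split of S3♭; `W`-free, `ι`-free: algebraic
number theory of `K` only). For every exponent `E` there are `γ ∈ 𝓞 K ∖ {0}` with `N(γ) ∈ ℚ^{×p}`, `γ ∉ K^{×p}`, and a finite bad set `T₀`,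
such that for every prime `ℓ₀ ∉ T₀` inert in `K` with `p^E ∣ ℓ₀ + 1` modulo which `γ` is not a `p`-th power, `p^E ∣ orderOf [𝔭_v]_{ℓ₀}` for
both primes `v ∣ q`. Informal proof (`q = 𝔮𝔮̄` split, `d_K < −4`): `(β₁) = 𝔮^{h}` with `h = h_𝔮` the order of `[𝔮]` in `Cl(𝓞_K)`,
`γ := β̄₁² · (q^{h})^{p−1}` (`N(γ) = (q^{2h})^p`; `γ ≡ x₁ := β̄₁/β₁ mod K^{×p}`, and `x₁ ∈ K^{×p}` would give `β̄₁ = β₁δ^p`, Hilbert 90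
`δ = ε̄/ε`, `β₁ = r' ε^p` with `r' ∈ ℚ^×`, and reading `𝔮`-, `𝔮̄`-valuations `[𝔮]^{h/p} = 1` — contradicting minimality of `h`), `T₀ := {q, 2, 3}`
(+ primes dividing `N(β₁)`); then in `𝔽_{λ₀} = 𝓞_K/ℓ₀`: `x̄₁ ∉ 𝔽_{λ₀}^{×p}` so `v_p ord(x̄₁) = v_p(ℓ₀² − 1) = v_p(ℓ₀ + 1) ≥ E` (`p` odd,
`ℓ₀ ≡ −1`); `β̄₁^{ℓ₀−1} = x̄₁^{-1}` (Frobenius of `𝔽_{λ₀}` = conj) and `u ↦ u^{ℓ₀−1}` kills exactly `𝔽_{ℓ₀}^× ⊇ 𝓞_K^× = ±1`, so the image of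
`β₁` in `(𝓞_K/ℓ₀)^×/(𝔽_{ℓ₀}^×·𝓞_K^×) ≅ ker(Pic 𝓞_{ℓ₀} → Cl 𝓞_K)` (the tree's theta-exactness `range_theta_eq_ker`, Cox (7.25)–(7.27)) has order
of `p`-adic valuation `≥ E`; `[𝔮]_{ℓ₀}^{h} = θ(β₁)` and `ord c = h · ord(c^{h})` when the image of `c` in `Cl` has order `h`; finally
`[𝔮̄]_{ℓ₀} = [(q)]_{ℓ₀} [𝔮]_{ℓ₀}^{-1} = [𝔮]_{ℓ₀}^{-1}`. A statement; asserted only by `stub_splitPrimeKummerWitness`.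
[cite: Cox2013, §7.C Prop. 7.22, §7.D (7.25)–(7.27), Thm. 7.24] [cite: NeukirchANT1999, Ch. I §9 (9.4), Ch. IV (Hilbert 90)] -/
def SplitPrimeKummerWitness (p q : ℕ) : Prop :=
  ∀ E : ℕ, ∃ (γ : 𝓞 K) (r : ℚ) (T₀ : Finset ℕ), γ ≠ 0 ∧ Algebra.norm ℚ (γ : K) = r ^ p ∧ (∀ y : K, y ^ p ≠ (γ : K)) ∧
    ∀ ℓ₀ : ℕ, ℓ₀.Prime → ℓ₀ ∉ T₀ → (Ideal.span {(ℓ₀ : 𝓞 K)}).IsPrime → p ^ E ∣ ℓ₀ + 1 →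
      (¬ ∃ y : 𝓞 K, y ^ p - γ ∈ Ideal.span {(ℓ₀ : 𝓞 K)}) →
      ∀ v : HeightOneSpectrum (𝓞 K), ((q : ℕ) : 𝓞 K) ∈ v.asIdeal → p ^ E ∣ orderOf (primeClass ℓ₀ v)

/-! ## Addendum (v15 registration, 2026-08-28): the K-LINEAR form of S1 (ideator bsd-idea-9 g9, `Lines/aux_norm_receptacle.lean` v5 §1, VERBATIM) —
requested by the S1 prover (width seat -w3 g6, HOME STATUS 15:09:03Z: the local construction is based at the places `v ∣ q` of `K`, so (K3) is natural for
`τ ∈ ringClassGal ι n` only); skeleton v15 registers `stub_tateComponentFamilyLinear` over THIS def; §2 of the composition holds from it unchanged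
(`AuxNormReceptacleLinear.labelE0Prime_at_splitCarrier_of_linear`). -/

/-- **S1-lin — the K-LINEAR form of S1 (v5).** `TateComponentFamily` with clause (K3) asked only for `τ ∈ 𝒢_n = Gal(K[n]/K)`
= `ringClassGal ι n` (the subgroup of `Aut_ℚ(K[n])` fixing `ι(K)`): this is ALL the composition of §2 consumes ((K3) is applied at
`τ = σ^i ∈ G_{ℓ₀} = ringClassGalOver ι (ℓ₀m₀) m₀ ≤ ringClassGal ι (ℓ₀m₀)`), and it is what a LOCAL construction based at the places
`v` of `K` (width seat -w3 g6: `exists_componentHom_of_tateNormalForm`, p642730, (4) = invariance under `Γ_{K_v}`, pulled back along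
K-embeddings `K[n] → K̄_v`) yields without comparing the data at `v` and `v̄`. The REGISTERED stub text (LEAD er5-p1 g3's
`Theorems/ErratumRoadFiveAuxNormReceptacleDefs.lean`, = v4) is the full clause over `Aut_ℚ(K[n])`, which is also true under `hs` (base the
construction at the rational place `q`: `W/ℚ` is split multiplicative over `ℚ_q`, ONE `ℚ_q`-rational change of variables to the Tate normal
form serves every `w ∣ q`, and embeddings `K[n] → ℚ̄_q` inducing the same place are `Γ_{ℚ_q}`-conjugate) — `tateComponentFamilyLinear_of`
records full ⟹ linear; a prover who lands only the K-linear form closes `labelE0Prime_at_splitCarrier_of_linear` below and asks the LEAD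
for a `--restate`. A statement, weaker than S1. [cite: SilvermanATAEC1994, IV Cor. 9.2 (d), V Thm. 3.1; C.15] [cite: GrossLMS1991, §4 (𝒢_n)] -/
def TateComponentFamilyLinear [∀ j : ℕ, NumberField (ringClassField K ι j)] (q : ℕ) : Prop :=
  ∃ comp : (n : ℕ) → HeightOneSpectrum (𝓞 (ringClassField K ι n)) →
      ((W.baseChange (ringClassField K ι n)).toAffine.Point →+ ZMod (padicValInt q W.minimalDiscriminantInt)),
    (∀ n : ℕ, n ≠ 0 → ¬ q ∣ n → ∀ (w : HeightOneSpectrum (𝓞 (ringClassField K ι n))),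
        ((q : ℕ) : 𝓞 (ringClassField K ι n)) ∈ w.asIdeal →
        ∀ P : (W.baseChange (ringClassField K ι n)).toAffine.Point,
          comp n w P = 0 ↔
            (placeIntModel W (ringClassField K ι n) w).HasNonsingularReduction (K := ringClassField K ι n) P) ∧
    (∀ n n₀ : ℕ, n ≠ 0 → ¬ q ∣ n → n₀ ∣ n →
        ∀ f : ringClassField K ι n₀ →ₐ[ℚ] ringClassField K ι n,
          (∀ x : ringClassField K ι n₀, ((f x : ringClassField K ι n) : ℂ) = (x : ℂ)) →
        ∀ w₀ : HeightOneSpectrum (𝓞 (ringClassField K ι n₀)),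
          ((q : ℕ) : 𝓞 (ringClassField K ι n₀)) ∈ w₀.asIdeal →
        ∃ w : HeightOneSpectrum (𝓞 (ringClassField K ι n)), ((q : ℕ) : 𝓞 (ringClassField K ι n)) ∈ w.asIdeal ∧
          ∀ P : (W.baseChange (ringClassField K ι n₀)).toAffine.Point,
            comp n w (WeierstrassCurve.Affine.Point.map (W' := W) f P) = comp n₀ w₀ P) ∧
    (∀ n : ℕ, n ≠ 0 → ¬ q ∣ n → ∀ (τ : ringClassField K ι n ≃ₐ[ℚ] ringClassField K ι n)
        (w w' : HeightOneSpectrum (𝓞 (ringClassField K ι n))),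
        τ ∈ ringClassGal ι n → w.asIdeal = τ • w'.asIdeal →
        ∀ P : (W.baseChange (ringClassField K ι n)).toAffine.Point,
          comp n w (pointGalHom W (ringClassField K ι n) τ P) = comp n w' P)

end Summit.BirchSwinnertonDyer.BirchSwinnertonDyer.Theorems.AuxNormReceptacle

end
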